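import Mathlib
import Summits.Ventures.PercRepro.PuncturedLYMMixT1Q1Table1

/-!
# PercRepro — (SP) FOR `1` PAIRWISE DISJOINT TRIPLES AND `1` PAIRWISE DISJOINT QUADRUPLES AT LEVEL `4`: POSITIVITY OF THE DENOMINATORS (1)
(p10, gen 41)

`den > 0`, `Pc > 0` for `n ≥ 7`; `Yc > 0` for `n ≥ 5`.  Nothing here asserts (SP).
-/

namespace PercRepro.PuncturedLYM.Split.TypeLift.MixT1Q1

/-- `den > 0` for `n ≥ 7`. -/
theorem den_pos (n : ℚ) (hn : 7 ≤ n) : 0 < den n := by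
  obtain ⟨n', hn', rfl⟩ : ∃ n', 0 ≤ n' ∧ n = 7 + n' := ⟨n - 7, by linarith, by ring⟩
  have h : den (7 + n') = 864 * n' ^ 8 + 41976 * n' ^ 7 + 891612 * n' ^ 6 + 10790592 * n' ^ 5 + 81168204 * n' ^ 4 + 387316944 * n' ^ 3 + 1139882352 * n' ^ 2 + 1879499136 * n' + 1315768320 := by unfold den; ring
  rw [h]; positivity

/-- `Yc > 0` for `n ≥ 5`. -/
theorem Yc_pos (n : ℚ) (hn : 5 ≤ n) : 0 < Yc n := by
  obtain ⟨n', hn', rfl⟩ : ∃ n', 0 ≤ n' ∧ n = 5 + n' := ⟨n - 5, by linarith, by ring⟩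
  have h : Yc (5 + n') = (1 / 120) * n' ^ 5 + (1 / 8) * n' ^ 4 + (17 / 24) * n' ^ 3 + (15 / 8) * n' ^ 2 + (137 / 60) * n' + 1 := by unfold Yc; ring
  rw [h]; positivity

/-- `Pc > 0` for `n ≥ 7`. -/
theorem Pc_pos (n : ℚ) (hn : 7 ≤ n) : 0 < Pc n := by
  obtain ⟨n', hn', rfl⟩ : ∃ n', 0 ≤ n' ∧ n = 7 + n' := ⟨n - 7, by linarith, by ring⟩
  have h : Pc (7 + n') = (1 / 24) * n' ^ 4 + (11 / 12) * n' ^ 3 + (179 / 24) * n' ^ 2 + (307 / 12) * n' + 30 := by unfold Pc; ring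
  rw [h]; positivity

end PercRepro.PuncturedLYM.Split.TypeLift.MixT1Q1
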